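import Summits.ABC.IUTFork.Repair.RcatLana91OrderReading
import Summits.ABC.IUTFork.Joshi.TestIsmScalingResults
import HarnessLib

/-!
# D-0123(C) IUT REPAIR-CATALOGUE, row RC-667 (LANA (9-1) ORDER variant), companion: the bridge hypothesis `finite` is
# LOAD-BEARING in `statement_of_dominated` — at block E's Joshi-scaling toy the order variant HOLDS and the Statement FAILS

Record file (D-0012) of the abc-iut cell, seat abc-iut-rcat-tst-2 (tester, KERNEL-CLOSE column); PROOF-ONLY (no definition, no
instance, no notation). TAKES NO SIDE on [IUTchIII] Cor. 3.12 / [IUTchIV] Thm. 1.10, on any reading, on Joshi's claims or on any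
author (D-0045); nothing here asserts abc proved or refuted. typed ≠ proved; located ≠ adjudicated.

`RcatLana91OrderReading` (§3, `Verbatim.statement_of_dominated_perPacket`) carries the ORDER variant of LANA's (9-1) — «some
global possible image `U` of the Θ-pilot object has `−|log(q)| ≤ PN_j Σ_{v_ℚ} ln μ^log(U_{j,v_ℚ})`» — to abc-iut-c312-7's verbatim
`Statement` UNDER abc-iut-c312-6's `BridgeHyps`, whose clause `finite` is c312-7's `ThetaFinite` («the quantity `−|log(Θ)|` is
finite», the Statement's own first conjunct). THIS FILE records that the clause cannot be dropped: at block E's test instantiation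
X-07′ (abc-iut-E-t41 `Joshi.IsmScaling.scalSetting p`, the «Joshi-style (Ind2)» scaling model over `toyIndex`; an
interface-level witness, NOT a model of initial Θ-data)

* `scalSetting_dominated_perPacket` — the order variant HOLDS, with equality, along the global choice «the `q`-pilot image in
  every packet» (Reading R3 holds there: E-t41 `scalSetting_reading3`, every ball is a possible image);
* `scalSetting_dominated_and_not_statement` — … while the typed `Statement` FAILS (`−|log(Θ)| = +∞`: the union of the possible
  images is a whole line, E-t41 `scalSetting_not_statement_not_bridgeHyps`) and `BridgeHyps` fails (at exactly the clause
  `finite`, E-t41 `scalSetting_bridge_census`);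
* `dominated_perPacket_not_imp_statement` — hence the bare implication «order variant ⟹ verbatim Statement», quantified over
  all settings, is FALSE: the order variant speaks to the inequality conjunct only; the finiteness conjunct is separate input.

[claim: Mochizuki2012, status: disputed] [claim: Joshi2024ATS3, status: disputed] [cite: LANA2026Report, §9.2 (9-1) p. 46]
-/

noncomputable section

namespace Summit.ABC

namespace IUTFork

namespace Repair.RcatLana91Order.Toy

open Joshi.IsmScaling Cor312 Cor312Vol Literature.IUT.LogThetaLattice

variable (p : ℕ) [hp : Fact p.Prime]

/-- **The order variant of (9-1) HOLDS at the X-07′ toy** `scalSetting p`: along the global choice `U_{j,v_ℚ} := ` the `q`-pilot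
image (a possible image of the Θ-pilot object in every packet at the labels of `𝔽_l^⋇`, E-t41 `scalSetting_reading3`), the
procession-normalised packet log-volume IS `−|log(q)|` (by the definition of c312-7's `negLogQ`), so `≤` holds. [folklore] -/
theorem scalSetting_dominated_perPacket :
    ∃ U : ImageChoice (scalSetting p), (scalSetting p).negLogQ ≤
      processionNormalized fun i => ∑ᶠ vQ,
        ((scalSituation p).D (scalSetting p).n).logvol (Setting.labelSucc i) vQ (U.1 (i, vQ)) :=
  ⟨⟨fun t => (scalSetting p).qRegion (Setting.labelSucc t.1) t.2, fun t => scalSetting_reading3 p t.1 t.2⟩, le_rfl⟩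

/-- **… and the typed Statement FAILS there, as do the bridge hypotheses** (E-t41 `scalSetting_not_statement_not_bridgeHyps`:
`−|log(Θ)| = +∞`, the possible images fill a line; `BridgeHyps` fails at the single clause `finite`). So at the verbatim level
the order variant does NOT give the Statement without the finiteness input. [folklore] -/
theorem scalSetting_dominated_and_not_statement :
    (∃ U : ImageChoice (scalSetting p), (scalSetting p).negLogQ ≤
      processionNormalized fun i => ∑ᶠ vQ,
        ((scalSituation p).D (scalSetting p).n).logvol (Setting.labelSucc i) vQ (U.1 (i, vQ))) ∧
      ¬ (scalSetting p).Statement ∧ ¬ BridgeHyps (scalSetting p) :=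
  ⟨scalSetting_dominated_perPacket p, scalSetting_not_statement_not_bridgeHyps p⟩

omit hp in
/-- **The bare implication «order variant (per-packet form) ⟹ verbatim Statement» is FALSE over all settings** (witness: the
X-07′ toy at `p = 2`). The hypothesis `BridgeHyps` of `Verbatim.statement_of_dominated_perPacket` — specifically its clause
`finite` = c312-7's `ThetaFinite`, the Statement's first conjunct — is load-bearing. [folklore] -/
theorem dominated_perPacket_not_imp_statement :
    ¬ ∀ (T : Thm311.ThetaIndex) (S : Thm311.Situation T) (P : Cor312.Setting S),
      (∃ U : ImageChoice P, P.negLogQ ≤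
        processionNormalized fun i : Fin T.lstar => ∑ᶠ vQ : T.VQ,
          (S.D P.n).logvol (Setting.labelSucc i) vQ (U.1 (i, vQ))) → P.Statement := by
  haveI : Fact (Nat.Prime 2) := ⟨Nat.prime_two⟩
  exact fun h => (scalSetting_not_statement_not_bridgeHyps 2).1 (h _ _ _ (scalSetting_dominated_perPacket 2))

end Repair.RcatLana91Order.Toy

end IUTFork

end Summit.ABC

end
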